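import Summits.ABC.ABC.Theses.CubicResolventAllowance
import Literature.NumberTheory.DiophantineGeometry.ValuationProductElliptic
import Literature.NumberTheory.EllipticCurves.BSDWave0

/-!
# Stub ideation k=2, generation 6 (RESHAPE, final) — `stub_complexCubic` of crux `IndexSzpiro`

Elaboration sanity for the two NEW typed items of `STUB-IDEAS-stub_complexCubic-2.md` (gen 6).
Everything else the gen-6 card lists is typed and kernel-checked in the earlier sketches of this
directory (`StubIdeas2G4Sketch.lean`, `StubIdeas2G5Sketch.lean`, `StubIdeas1G5Sketch.lean`,
`StubIdeas1G6Sketch.lean`, `StubIdeas3ComplexG3Sketch.lean`) and is cited there BY NAME, not retyped.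
Scratch namespace; nothing here is a tree proposal; `sorry` only in helper bodies that are prover work.
-/

open Polynomial

namespace Summit.ABC.ABC.Cruxes.IndexSzpiro.StubIdeas2G6

open Summit.ABC.ABC.Theses.CubicResolventAllowance (IndexSzpiro)
open Literature.NumberTheory.DiophantineGeometry (mestreOesterle1989_thm_1)
open Literature.NumberTheory.EllipticCurves (mazur_torsion)

/-- `stub_complexCubic` (signature verbatim from the registered skeleton). -/
def Stub : Prop :=
  ∀ ε : ℝ, 0 < ε → ∃ C : ℝ, ∀ (W : WeierstrassCurve ℚ) [W.IsElliptic] (K : Type) [Field K]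
    [NumberField K], Irreducible W.twoTorsionPolynomial.toPoly → Module.finrank ℚ K = 3 →
    (∃ θ : K, aeval θ W.twoTorsionPolynomial.toPoly = 0) → NumberField.discr K < 0 →
    (W.minimalDiscriminantNorm ℤ : ℝ) ≤
      C * |(NumberField.discr K : ℝ)| * (W.conductorNorm ℤ : ℝ) ^ (6 + ε)

/-! ## §3 Regime ω(N) = 1 — the second rung after the route's prime-conductor BC5 rung -/

/-- **W1 `PrimeSqConductorRung` (target of §3; S from W1a + W1b + the named fact M–O).**
Conductor `p²`, `p ≥ 5` ⟹ `Δ_min ∣ p¹¹` (`< p¹² = N⁶`: Szpiro `6` at `ε = 0`, `C = 1`). -/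
def PrimeSqConductorRung : Prop :=
  ∀ (W : WeierstrassCurve ℚ) [W.IsElliptic] (p : ℕ), p.Prime → 5 ≤ p →
    W.conductorNorm ℤ = p ^ 2 → W.minimalDiscriminantNorm ℤ ∣ p ^ 11

/-- **W1a (M) potentially-good branch.** Additive at `p ≥ 5` with `v_p(j) ≥ 0` ⟹ `v_p(Δ_min) ≤ 10`
(Néron–Kodaira: `v_p(Δ_min) ∈ {2,3,4,6,8,9,10}`; = k3 L3a `ordMinDisc_le_of_potGood` with `f_p = 2`);
good reduction elsewhere because `N = p²`. -/
def PotGoodBranch : Prop :=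
  ∀ (W : WeierstrassCurve ℚ) [W.IsElliptic] (p : ℕ), p.Prime → 5 ≤ p →
    W.conductorNorm ℤ = p ^ 2 → 0 ≤ padicValRat p W.j → W.minimalDiscriminantNorm ℤ ∣ p ^ 10

/-- **W1b (M) potentially-multiplicative branch = twist down to prime conductor.** Additive at
`p ≥ 5` with `v_p(j) < 0` ⟹ `E` is the quadratic twist by `p* = (-1)^{(p-1)/2} p` (ramified only at
`p`) of a curve `E'` with multiplicative reduction at `p` and good reduction elsewhere, and
`Δ_min(E) = p⁶ Δ_min(E')` [Silverman ATAEC V.5.1; twist table, corpus:silverman1994 p.368]. -/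
def PotMultTwistBranch : Prop :=
  ∀ (W : WeierstrassCurve ℚ) [W.IsElliptic] (p : ℕ), p.Prime → 5 ≤ p →
    W.conductorNorm ℤ = p ^ 2 → padicValRat p W.j < 0 →
    ∃ (W' : WeierstrassCurve ℚ) (_ : W'.IsElliptic), W'.conductorNorm ℤ = p ∧
      W.minimalDiscriminantNorm ℤ = p ^ 6 * W'.minimalDiscriminantNorm ℤ

/-- (S, VERIFIED) assembly of §3: W1a + W1b + Mestre–Oesterlé (named fact, hypothesis) ⟹ W1. -/
theorem primeSqConductorRung_of (hMO : mestreOesterle1989_thm_1) (hg : PotGoodBranch)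
    (hm : PotMultTwistBranch) : PrimeSqConductorRung := by
  intro W _ p hp h5 hN
  by_cases hj : 0 ≤ padicValRat p W.j
  · exact (hg W p hp h5 hN hj).trans (pow_dvd_pow p (by norm_num))
  · have hj : padicValRat p W.j < 0 := lt_of_not_ge hj
    obtain ⟨W', hW', hN', hΔ⟩ := hm W p hp h5 hN hj
    haveI : W'.IsElliptic := hW'
    have hprime : (W'.conductorNorm ℤ).Prime := by rw [hN']; exact hp
    have h5' := hMO W' hprime
    rw [hN'] at h5'
    rw [hΔ, show p ^ 11 = p ^ 6 * p ^ 5 by ring]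
    exact mul_dvd_mul_left _ h5'

/-- (S, VERIFIED) W1 in the stub's currency: on conductor `p²` the stub's inequality holds at
`ε`-uniform constant `C = 1` (indeed `Δ_min ≤ N^{11/2} ≤ |d_K|·N⁶`, `|d_K| ≥ 1`). -/
theorem stubIneq_of_primeSq (h : PrimeSqConductorRung) (W : WeierstrassCurve ℚ) [W.IsElliptic]
    (K : Type) [Field K] [NumberField K] (p : ℕ) (hp : p.Prime) (h5 : 5 ≤ p)
    (hN : W.conductorNorm ℤ = p ^ 2) {ε : ℝ} (hε : 0 < ε) :
    (W.minimalDiscriminantNorm ℤ : ℝ) ≤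
      1 * |(NumberField.discr K : ℝ)| * (W.conductorNorm ℤ : ℝ) ^ (6 + ε) := by
  have hp1 : 1 ≤ p := hp.one_lt.le
  have hdvd : W.minimalDiscriminantNorm ℤ ∣ p ^ 11 := h W p hp h5 hN
  have hle : W.minimalDiscriminantNorm ℤ ≤ p ^ 11 := Nat.le_of_dvd (by positivity) hdvd
  have hle12 : (W.minimalDiscriminantNorm ℤ : ℝ) ≤ (p : ℝ) ^ 12 := by
    have : (p : ℝ) ^ 11 ≤ (p : ℝ) ^ 12 := pow_le_pow_right₀ (by exact_mod_cast hp1) (by norm_num)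
    exact le_trans (by exact_mod_cast hle) this
  have hd : (1 : ℝ) ≤ |(NumberField.discr K : ℝ)| := by
    have h0 : (1 : ℤ) ≤ |NumberField.discr K| := Int.one_le_abs (NumberField.discr_ne_zero K)
    have : ((1 : ℤ) : ℝ) ≤ ((|NumberField.discr K| : ℤ) : ℝ) := by exact_mod_cast h0
    simpa [Int.cast_abs] using this
  have hNreal : (W.conductorNorm ℤ : ℝ) = (p : ℝ) ^ 2 := by rw [hN]; push_cast; ring
  have hp1r : (1 : ℝ) ≤ (p : ℝ) ^ 2 := one_le_pow₀ (by exact_mod_cast hp1)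
  have hpow : (p : ℝ) ^ 12 ≤ (W.conductorNorm ℤ : ℝ) ^ (6 + ε) := by
    rw [hNreal]
    have h6 : ((p : ℝ) ^ 2) ^ (6 : ℝ) = (p : ℝ) ^ 12 := by
      rw [show (6 : ℝ) = ((6 : ℕ) : ℝ) by norm_num, Real.rpow_natCast]; ring
    calc (p : ℝ) ^ 12 = ((p : ℝ) ^ 2) ^ (6 : ℝ) := h6.symm
      _ ≤ ((p : ℝ) ^ 2) ^ (6 + ε) :=
            Real.rpow_le_rpow_of_exponent_le hp1r (by linarith)
  calc (W.minimalDiscriminantNorm ℤ : ℝ) ≤ (p : ℝ) ^ 12 := hle12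
    _ ≤ (W.conductorNorm ℤ : ℝ) ^ (6 + ε) := hpow
    _ = 1 * 1 * (W.conductorNorm ℤ : ℝ) ^ (6 + ε) := by ring
    _ ≤ 1 * |(NumberField.discr K : ℝ)| * (W.conductorNorm ℤ : ℝ) ^ (6 + ε) := by
          gcongr

/-! ## §4 Refuter-side pencil as a LEMMA: every `X₁(7)` fibre is in the class (Mazur) -/

/-- **P7 (M) `irreducible_twoTorsion_of_sevenTorsion`.** A rational point of order `7` forbids a
rational point of order `2` (`ℤ/14`, `ℤ/2 × ℤ/14` are not in Mazur's list), and a rational root of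
`ψ₂` IS a rational `2`-torsion point; so `ψ₂` is irreducible on every fibre of the Tate normal form
`E(b,c)`, `b = t³ - t²`, `c = t² - t` (`X₁(7) ≅ ℙ¹`) — an infinite explicit sub-family of the class,
semistable away from `7`, replacing per-fibre irreducibility checks in the kill instrument (ι, K1). -/
def SevenTorsionInClass : Prop :=
  ∀ (W : WeierstrassCurve ℚ) [W.IsElliptic], mazur_torsion W →
    (∃ P : W.toAffine.Point, addOrderOf P = 7) → Irreducible W.twoTorsionPolynomial.toPoly

theorem sevenTorsionInClass : SevenTorsionInClass := by
  sorry

end Summit.ABC.ABC.Cruxes.IndexSzpiro.StubIdeas2G6
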